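import Literature.NumberTheory.Transcendental.UnivExtThetaAddition
import HarnessLib

/-!
# The polynomial relations among the block theta functions `P_i`, `Z_i` of `E♮`

Topic `Literature/NumberTheory/Transcendental`. A brick for the theta-model instance of the
abstract zero estimate (`ZeroEstModel.lean`: the relations of `Θ`, its Jacobian data and its
Wronskians are read off chart-wise from the relations of one block). With
`P = σ³ (1, ℘, ℘′)` and `Z = σ³ (ζ, ℘ζ, ℘′ζ + 2℘²)` (`PeriodPair.univExtP/Z`, entire), the
Weierstrass equation and the definition of the companions give the identities, valid on all of
`ℂ` (off the lattice by `℘′² = 4℘³ - g₂℘ - g₃`, on the lattice by continuity and density):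

* `univExtP_cubic`: `P₂² P₀ = 4 P₁³ - g₂ P₁ P₀² - g₃ P₀³`;
* `univExtZ_zero_mul_univExtP_one`: `Z₀ P₁ = Z₁ P₀`;
* `univExtZ_zero_mul_univExtP_two_sub`: `Z₀ P₂ - Z₂ P₀ = -2 P₁²`;
* `two_mul_univExtZ_one_mul_univExtP_two_sub`: `2 (Z₁ P₂ - Z₂ P₁) = -(P₂² + g₂ P₀ P₁ + g₃ P₀²)`.

Everything is PROVED; no named facts.

## References

* E. T. Whittaker, G. N. Watson, *A Course of Modern Analysis*, 4th ed., CUP 1927, §20.22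
  (`℘′² = 4℘³ - g₂℘ - g₃`), §20.4–20.53 (`ζ`, `σ`). [WhittakerWatson1927]
-/

noncomputable section

namespace Literature.NumberTheory.Transcendental

variable (L : PeriodPair)

/-- Two continuous functions on `ℂ` that agree off the lattice agree. [folklore] -/
theorem _root_.PeriodPair.eq_of_eqOn_compl_lattice {f g : ℂ → ℂ} (hf : Continuous f) (hg : Continuous g)
    (h : ∀ z, z ∉ L.lattice → f z = g z) : f = g :=
  Continuous.ext_on L.dense_compl_lattice hf hg fun z hz => h z hz

/-- **The Weierstrass cubic for the entire sections**: `P₂² P₀ = 4 P₁³ - g₂ P₁ P₀² - g₃ P₀³`.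
[cite: WhittakerWatson1927, §20.22] -/
theorem _root_.PeriodPair.univExtP_cubic (z : ℂ) :
    L.univExtP 2 z ^ 2 * L.univExtP 0 z =
      4 * L.univExtP 1 z ^ 3 - L.g₂ * L.univExtP 1 z * L.univExtP 0 z ^ 2 - L.g₃ * L.univExtP 0 z ^ 3 := by
  have hc : ∀ i, Continuous (L.univExtP i) := fun i => (L.differentiable_univExtP i).continuous
  have key : (fun z => L.univExtP 2 z ^ 2 * L.univExtP 0 z) = fun z =>
      4 * L.univExtP 1 z ^ 3 - L.g₂ * L.univExtP 1 z * L.univExtP 0 z ^ 2 - L.g₃ * L.univExtP 0 z ^ 3 := by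
    refine L.eq_of_eqOn_compl_lattice (((hc 2).pow 2).mul (hc 0))
      (((continuous_const.mul ((hc 1).pow 3)).sub ((continuous_const.mul (hc 1)).mul ((hc 0).pow 2))).sub
        (continuous_const.mul ((hc 0).pow 3))) fun w hw => ?_
    obtain ⟨p0, p1, p2⟩ := PeriodPair.univExtP_eq (L := L) hw
    have hode := L.derivWeierstrassP_sq w hw
    show L.univExtP 2 w ^ 2 * L.univExtP 0 w =
      4 * L.univExtP 1 w ^ 3 - L.g₂ * L.univExtP 1 w * L.univExtP 0 w ^ 2 - L.g₃ * L.univExtP 0 w ^ 3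
    rw [p0, p1, p2]
    linear_combination (L.weierstrassSigma w ^ 9) * hode
  exact congr_fun key z

/-- **`Z₀ P₁ = Z₁ P₀`.** [folklore] -/
theorem _root_.PeriodPair.univExtZ_zero_mul_univExtP_one (z : ℂ) :
    L.univExtZ 0 z * L.univExtP 1 z = L.univExtZ 1 z * L.univExtP 0 z := by
  have hc : ∀ i, Continuous (L.univExtP i) := fun i => (L.differentiable_univExtP i).continuous
  have hz : ∀ i, Continuous (L.univExtZ i) := fun i => (L.differentiable_univExtZ i).continuous
  have key : (fun z => L.univExtZ 0 z * L.univExtP 1 z) = fun z => L.univExtZ 1 z * L.univExtP 0 z := by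
    refine L.eq_of_eqOn_compl_lattice ((hz 0).mul (hc 1)) ((hz 1).mul (hc 0)) fun w hw => ?_
    obtain ⟨p0, p1, -⟩ := PeriodPair.univExtP_eq (L := L) hw
    obtain ⟨z0, z1, -⟩ := PeriodPair.univExtZ_eq (L := L) hw
    show L.univExtZ 0 w * L.univExtP 1 w = L.univExtZ 1 w * L.univExtP 0 w
    rw [p0, p1, z0, z1]
    ring
  exact congr_fun key z

/-- **`Z₀ P₂ - Z₂ P₀ = -2 P₁²`.** [folklore] -/
theorem _root_.PeriodPair.univExtZ_zero_mul_univExtP_two_sub (z : ℂ) :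
    L.univExtZ 0 z * L.univExtP 2 z - L.univExtZ 2 z * L.univExtP 0 z = -2 * L.univExtP 1 z ^ 2 := by
  have hc : ∀ i, Continuous (L.univExtP i) := fun i => (L.differentiable_univExtP i).continuous
  have hz : ∀ i, Continuous (L.univExtZ i) := fun i => (L.differentiable_univExtZ i).continuous
  have key : (fun z => L.univExtZ 0 z * L.univExtP 2 z - L.univExtZ 2 z * L.univExtP 0 z) =
      fun z => -2 * L.univExtP 1 z ^ 2 := by
    refine L.eq_of_eqOn_compl_lattice (((hz 0).mul (hc 2)).sub ((hz 2).mul (hc 0)))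
      (continuous_const.mul ((hc 1).pow 2)) fun w hw => ?_
    obtain ⟨p0, p1, p2⟩ := PeriodPair.univExtP_eq (L := L) hw
    obtain ⟨z0, -, z2⟩ := PeriodPair.univExtZ_eq (L := L) hw
    show L.univExtZ 0 w * L.univExtP 2 w - L.univExtZ 2 w * L.univExtP 0 w = -2 * L.univExtP 1 w ^ 2
    rw [p0, p1, p2, z0, z2]
    ring
  exact congr_fun key z

/-- **`2 (Z₁ P₂ - Z₂ P₁) = -(P₂² + g₂ P₀ P₁ + g₃ P₀²)`** (the Weierstrass cubic divided by `P₀`).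
[cite: WhittakerWatson1927, §20.22] -/
theorem _root_.PeriodPair.two_mul_univExtZ_one_mul_univExtP_two_sub (z : ℂ) :
    2 * (L.univExtZ 1 z * L.univExtP 2 z - L.univExtZ 2 z * L.univExtP 1 z) =
      -(L.univExtP 2 z ^ 2 + L.g₂ * L.univExtP 0 z * L.univExtP 1 z + L.g₃ * L.univExtP 0 z ^ 2) := by
  have hc : ∀ i, Continuous (L.univExtP i) := fun i => (L.differentiable_univExtP i).continuous
  have hz : ∀ i, Continuous (L.univExtZ i) := fun i => (L.differentiable_univExtZ i).continuous
  have key : (fun z => 2 * (L.univExtZ 1 z * L.univExtP 2 z - L.univExtZ 2 z * L.univExtP 1 z)) =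
      fun z => -(L.univExtP 2 z ^ 2 + L.g₂ * L.univExtP 0 z * L.univExtP 1 z + L.g₃ * L.univExtP 0 z ^ 2) := by
    refine L.eq_of_eqOn_compl_lattice (continuous_const.mul (((hz 1).mul (hc 2)).sub ((hz 2).mul (hc 1))))
      ((((hc 2).pow 2).add ((continuous_const.mul (hc 0)).mul (hc 1))).add (continuous_const.mul ((hc 0).pow 2))).neg
      fun w hw => ?_
    obtain ⟨p0, p1, p2⟩ := PeriodPair.univExtP_eq (L := L) hw
    obtain ⟨-, z1, z2⟩ := PeriodPair.univExtZ_eq (L := L) hw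
    have hode := L.derivWeierstrassP_sq w hw
    show 2 * (L.univExtZ 1 w * L.univExtP 2 w - L.univExtZ 2 w * L.univExtP 1 w) =
      -(L.univExtP 2 w ^ 2 + L.g₂ * L.univExtP 0 w * L.univExtP 1 w + L.g₃ * L.univExtP 0 w ^ 2)
    rw [p0, p1, p2, z1, z2]
    linear_combination (L.weierstrassSigma w ^ 6) * hode
  exact congr_fun key z

end Literature.NumberTheory.Transcendental
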